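import Mathlib
import Literature.Topology.PlaneTopology.Janiszewski
import Literature.Topology.FourManifolds.LickorishWallaceProofs
import HarnessLib

/-!
# Continuous logarithms on round spheres in `ℝ³`; the 2-sphere is unicoherent; level sets of
# functions with connected super- and sub-level sets

Topic `Literature/Topology/Euclidean`.  For a round sphere `S = S_r(x₀) ⊆ ℝ³ = EuclideanSpace ℝ (Fin 3)`, `r > 0`:

* `SphereUnicoherence.exists_log_union` — logarithms of one nowhere-vanishing `ℂ`-valued function on two closed sets
  whose intersection is preconnected glue to a logarithm on the union (the lemma of
  `Literature.Topology.PlaneTopology.Janiszewski.exists_log_union`, verbatim argument, for an arbitrary topological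
  space instead of `ℂ`);
* `SphereUnicoherence.exists_log_cap`, `SphereUnicoherence.exists_log_sphere` — **every continuous nowhere-vanishing
  `φ : S → ℂ` has a continuous logarithm** (the 2-sphere is simply connected; Eilenberg 1936).  Proof without
  homotopy theory: each closed hemisphere `{±(x − x₀)₂ ≥ 0} ∩ S` is the graph of `w ↦ ±√(r² − |w|²)` over the
  closed disc `|w| ≤ r` of `ℂ`; pulling `φ` back along graph ∘ (radial retraction `ℂ → disc`) gives a nowhere-vanishing
  map on `ℂ`, which has a logarithm (`Janiszewski.exists_continuous_log`, covering theory of `exp`); the two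
  hemisphere logarithms glue along the equator, a circle (connected);
* `SphereUnicoherence.isPreconnected_inter` — **the 2-sphere is unicoherent**: closed connected `A, B ⊆ S` with
  `A ∪ B = S` have connected intersection (Eilenberg's argument: were `A ∩ B = C₁ ⊔ C₂`, a Urysohn function
  `θ` (`0` on `C₁`, `1` on `C₂`) defines the nowhere-vanishing map `e^{iπθ}` on `A`, `e^{−iπθ}` on `B`; its logarithm
  `ψ` has `ψ − iπθ` constant on `A` and `ψ + iπθ` constant on `B`, which is absurd at a point of `C₁` and one of `C₂`);
* `SphereUnicoherence.isPreconnected_superlevel_le`, `…_sublevel_le`, `…_levelSet` — for `f` continuous on `S` all of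
  whose STRICT super- and sub-level sets are preconnected (a «unimodal», saddle-free function), the sets `{f ≥ c}`,
  `{f ≤ c}` (nested intersections of compact connected closures, the tree's
  `Literature.Topology.FourManifolds.isPreconnected_iInter_of_antitone`) and hence, by unicoherence, every LEVEL SET
  `{f = c}` are preconnected.

Sources: S. Eilenberg, *Transformations continues en circonférence et la topologie du plan*, Fund. Math. 26 (1936)
(logarithm criterion, unicoherence); K. Kuratowski, *Topology* II (1968) §57 (unicoherence of `Sⁿ`, `n ≥ 2`);
G. T. Whyburn, *Analytic Topology* (1942) Ch. XI.  Mathlib has no unicoherence and no simple connectivity of spheres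
(searched `unicoheren`, `SimplyConnectedSpace` + `sphere`); everything used is Mathlib + the tree's Janiszewski file.
Not here: higher-dimensional spheres, general simply connected spaces.
-/

noncomputable section

namespace Literature.Topology.Euclidean

open Set Metric Filter Complex _root_.Topology
open scoped Real

namespace SphereUnicoherence

/-! ### Gluing logarithms (arbitrary topological space) -/

/-- Logarithms of the same nowhere-vanishing function on closed sets `A` and `B` whose intersection is preconnected
glue (after adding a constant in `2πiℤ` on `B`) to a continuous logarithm on `A ∪ B` — the argument of
`Literature.Topology.PlaneTopology.Janiszewski.exists_log_union` on an arbitrary topological space (Eilenberg 1936 §1;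
Kuratowski, *Topology* II §56, exponential representation of maps into the circle). [cite: Kuratowski1968, §56 I] -/
theorem exists_log_union {X : Type*} [TopologicalSpace X] {A B : Set X} (hA : IsClosed A) (hB : IsClosed B)
    (hAB : IsPreconnected (A ∩ B)) {f gA gB : X → ℂ} (hf : ∀ z ∈ B, f z ≠ 0)
    (hgA : ContinuousOn gA A) (hA' : ∀ z ∈ A, exp (gA z) = f z)
    (hgB : ContinuousOn gB B) (hB' : ∀ z ∈ B, exp (gB z) = f z) :
    ∃ g : X → ℂ, ContinuousOn g (A ∪ B) ∧ ∀ z ∈ A ∪ B, exp (g z) = f z := by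
  classical
  -- the difference `gA - gB` is a constant `c ∈ 2πiℤ` on `A ∩ B`
  obtain ⟨c, hc1, hc⟩ : ∃ c : ℂ, exp c = 1 ∧ ∀ z ∈ A ∩ B, gA z = gB z + c := by
    rcases (A ∩ B).eq_empty_or_nonempty with he | ⟨z₀, hz₀⟩
    · exact ⟨0, exp_zero, fun z hz ↦ by rw [he] at hz; exact hz.elim⟩
    have hdiff : ∀ z ∈ A ∩ B, exp (gA z - gB z) = 1 := fun z hz ↦ by
      rw [exp_sub, hA' z hz.1, hB' z hz.2, div_self (hf z hz.2)]
    set T : Set ℂ := (AddSubgroup.zmultiples (2 * Real.pi * I) : Set ℂ) with hT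
    have hTd : IsDiscrete T :=
      isDiscrete_iff_discreteTopology.2 (NormedSpace.discreteTopology_zmultiples _)
    have hmaps : MapsTo (fun z ↦ gA z - gB z) (A ∩ B) T := fun z hz ↦ by
      obtain ⟨n, hn⟩ := exp_eq_one_iff.1 (hdiff z hz)
      rw [hT, SetLike.mem_coe, AddSubgroup.mem_zmultiples_iff]
      exact ⟨n, by simp only [hn, zsmul_eq_mul]⟩
    have hcont : ContinuousOn (fun z ↦ gA z - gB z) (A ∩ B) :=
      (hgA.mono inter_subset_left).sub (hgB.mono inter_subset_right)
    refine ⟨gA z₀ - gB z₀, hdiff z₀ hz₀, fun z hz ↦ ?_⟩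
    have := hAB.constant_of_mapsTo hTd hcont hmaps hz hz₀
    rw [← this]; ring
  refine ⟨fun z ↦ if z ∈ A then gA z else gB z + c, ?_, fun z hz ↦ ?_⟩
  · refine ContinuousOn.union_of_isClosed ?_ ?_ hA hB
    · exact hgA.congr fun z hz ↦ by simp [hz]
    · have hgB' : ContinuousOn (fun z ↦ gB z + c) B := hgB.add continuousOn_const
      refine hgB'.congr fun z hz ↦ ?_
      by_cases hzA : z ∈ A
      · simp [hzA, hc z ⟨hzA, hz⟩]
      · simp [hzA]
  · by_cases hzA : z ∈ A
    · simp only [if_pos hzA, hA' z hzA]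
    · have hzB : z ∈ B := hz.resolve_left hzA
      simp only [if_neg hzA, exp_add, hB' z hzB, hc1, mul_one]

/-! ### Coordinates on `ℝ³` -/

/-- The coordinate functions of `EuclideanSpace ℝ (Fin 3)` are continuous. [folklore] -/
private theorem continuous_coord (i : Fin 3) : Continuous fun x : EuclideanSpace ℝ (Fin 3) => x i :=
  (EuclideanSpace.proj i).continuous

/-- The norm on `ℝ³` in coordinates: `‖y‖² = y₀² + y₁² + y₂²`. [folklore] -/
private theorem norm_sq_eq_coord (y : EuclideanSpace ℝ (Fin 3)) : ‖y‖ ^ 2 = y 0 ^ 2 + y 1 ^ 2 + y 2 ^ 2 := by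
  rw [EuclideanSpace.norm_eq, Real.sq_sqrt (Finset.sum_nonneg fun i _ => sq_nonneg _), Fin.sum_univ_three]
  simp only [Real.norm_eq_abs, sq_abs]

/-- Real and imaginary part of `a + b i` for real `a, b`. [folklore] -/
private theorem re_ofReal_add_ofReal_mul_I (a b : ℝ) : ((a : ℂ) + (b : ℂ) * I).re = a ∧ ((a : ℂ) + (b : ℂ) * I).im = b := by
  constructor <;> simp

/-- `‖a + b i‖² = a² + b²` for real `a, b`. [folklore] -/
private theorem norm_sq_ofReal_add_ofReal_mul_I (a b : ℝ) : ‖(a : ℂ) + (b : ℂ) * I‖ ^ 2 = a ^ 2 + b ^ 2 := by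
  rw [Complex.sq_norm, Complex.normSq_apply, (re_ofReal_add_ofReal_mul_I a b).1, (re_ofReal_add_ofReal_mul_I a b).2]
  ring

/-! ### Logarithms on a closed hemisphere -/

/-- **A nowhere-vanishing continuous function on the sphere `S_r(x₀)` has a continuous logarithm on each closed
hemisphere `{x ∈ S_r(x₀) : s·(x − x₀)₂ ≥ 0}`, `s = ±1`.**  The hemisphere is the graph of `w ↦ s√(r² − |w|²)` over the
closed disc `|w| ≤ r ⊂ ℂ`; compose with the radial retraction of `ℂ` onto the disc and take a logarithm on `ℂ`
(`Janiszewski.exists_continuous_log`).  (Eilenberg 1936 §1; Kuratowski, *Topology* II §56: maps of simply connected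
sets into the circle are exponentially representable.) [cite: Kuratowski1968, §56 VI] -/
theorem exists_log_cap (x₀ : EuclideanSpace ℝ (Fin 3)) {r : ℝ} (hr : 0 < r) {s : ℝ} (hs : s = 1 ∨ s = -1)
    {φ : EuclideanSpace ℝ (Fin 3) → ℂ} (hφ : ContinuousOn φ (sphere x₀ r)) (h0 : ∀ x ∈ sphere x₀ r, φ x ≠ 0) :
    ∃ ψ : EuclideanSpace ℝ (Fin 3) → ℂ, Continuous ψ ∧
      ∀ x ∈ sphere x₀ r, 0 ≤ s * (x - x₀) 2 → exp (ψ x) = φ x := by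
  have hs2 : s ^ 2 = 1 := by rcases hs with rfl | rfl <;> norm_num
  -- the planar projection, the graph map and the retraction
  set proj : EuclideanSpace ℝ (Fin 3) → ℂ := fun x => ((x - x₀) 0 : ℂ) + ((x - x₀) 1 : ℂ) * I with hproj
  set lift : ℂ → EuclideanSpace ℝ (Fin 3) := fun w => x₀ +
    ((w.re) • EuclideanSpace.single (0 : Fin 3) (1 : ℝ) + (w.im) • EuclideanSpace.single (1 : Fin 3) (1 : ℝ)
      + (s * Real.sqrt (r ^ 2 - ‖w‖ ^ 2)) • EuclideanSpace.single (2 : Fin 3) (1 : ℝ)) with hlift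
  set ρ : ℂ → ℂ := fun w => ((r / max r ‖w‖ : ℝ) : ℂ) * w with hρ
  have hproj_cont : Continuous proj := by
    refine (continuous_ofReal.comp ?_).add ((continuous_ofReal.comp ?_).mul continuous_const)
    · exact (continuous_coord 0).comp (continuous_id.sub continuous_const)
    · exact (continuous_coord 1).comp (continuous_id.sub continuous_const)
  have hlift_cont : Continuous lift := by
    refine continuous_const.add ((?_ : Continuous _).add ?_)
    · exact (continuous_re.smul continuous_const).add (continuous_im.smul continuous_const)
    · exact (continuous_const.mul ((continuous_const.sub (continuous_norm.pow 2)).sqrt)).smul continuous_const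
  have hmax_pos : ∀ w : ℂ, 0 < max r ‖w‖ := fun w => lt_max_of_lt_left hr
  have hρ_cont : Continuous ρ := by
    refine (continuous_ofReal.comp ?_).mul continuous_id
    exact continuous_const.div (continuous_const.max continuous_norm) fun w => (hmax_pos w).ne'
  have hρ_norm : ∀ w, ‖ρ w‖ ≤ r := by
    intro w
    simp only [hρ, norm_mul, Complex.norm_real, Real.norm_eq_abs]
    rw [abs_of_pos (div_pos hr (hmax_pos w)), div_mul_eq_mul_div, div_le_iff₀ (hmax_pos w)]
    exact mul_le_mul_of_nonneg_left (le_max_right _ _) hr.le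
  have hρ_id : ∀ w : ℂ, ‖w‖ ≤ r → ρ w = w := by
    intro w hw
    simp only [hρ, max_eq_left hw, div_self hr.ne', Complex.ofReal_one, one_mul]
  -- coordinates of `lift w - x₀`
  have hl0 : ∀ w : ℂ, (lift w - x₀) 0 = w.re := by intro w; simp [hlift]
  have hl1 : ∀ w : ℂ, (lift w - x₀) 1 = w.im := by intro w; simp [hlift]
  have hl2 : ∀ w : ℂ, (lift w - x₀) 2 = s * Real.sqrt (r ^ 2 - ‖w‖ ^ 2) := by intro w; simp [hlift]
  have hw2 : ∀ w : ℂ, w.re ^ 2 + w.im ^ 2 = ‖w‖ ^ 2 := fun w => by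
    rw [Complex.sq_norm, Complex.normSq_apply]; ring
  -- `lift` maps the closed disc into the sphere
  have hlift_mem : ∀ w : ℂ, ‖w‖ ≤ r → lift w ∈ sphere x₀ r := by
    intro w hw
    have hnn : 0 ≤ r ^ 2 - ‖w‖ ^ 2 := by nlinarith [norm_nonneg w]
    have hsq : ‖lift w - x₀‖ ^ 2 = r ^ 2 := by
      rw [norm_sq_eq_coord, hl0, hl1, hl2, mul_pow, hs2, one_mul, Real.sq_sqrt hnn, hw2]
      ring
    rw [mem_sphere_iff_norm]
    nlinarith [norm_nonneg (lift w - x₀)]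
  -- on the hemisphere, `proj` lands in the disc and `lift ∘ proj = id`
  have hproj_re : ∀ x, (proj x).re = (x - x₀) 0 := fun x => (re_ofReal_add_ofReal_mul_I _ _).1
  have hproj_im : ∀ x, (proj x).im = (x - x₀) 1 := fun x => (re_ofReal_add_ofReal_mul_I _ _).2
  have hproj_sq : ∀ x ∈ sphere x₀ r, ‖proj x‖ ^ 2 = r ^ 2 - ((x - x₀) 2) ^ 2 := by
    intro x hx
    rw [mem_sphere_iff_norm] at hx
    rw [hproj, norm_sq_ofReal_add_ofReal_mul_I, ← hx, norm_sq_eq_coord]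
    ring
  have hproj_le : ∀ x ∈ sphere x₀ r, ‖proj x‖ ≤ r := by
    intro x hx
    have h := hproj_sq x hx
    nlinarith [norm_nonneg (proj x), sq_nonneg ((x - x₀) 2)]
  have hlift_proj : ∀ x ∈ sphere x₀ r, 0 ≤ s * (x - x₀) 2 → lift (proj x) = x := by
    intro x hx hsx
    have hsqrt : Real.sqrt (r ^ 2 - ‖proj x‖ ^ 2) = |(x - x₀) 2| := by
      rw [hproj_sq x hx, sub_sub_cancel, Real.sqrt_sq_eq_abs]
    have h3 : s * Real.sqrt (r ^ 2 - ‖proj x‖ ^ 2) = (x - x₀) 2 := by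
      rw [hsqrt]
      rcases hs with rfl | rfl
      · rw [one_mul] at hsx ⊢; exact abs_of_nonneg hsx
      · have : (x - x₀) 2 ≤ 0 := by linarith
        rw [abs_of_nonpos this]; ring
    rw [← sub_left_inj (a := x₀)]  -- compare `lift (proj x) - x₀` with `x - x₀`
    ext i
    fin_cases i
    · exact (hl0 _).trans (hproj_re x)
    · exact (hl1 _).trans (hproj_im x)
    · exact (hl2 _).trans h3
  -- pull back, take a logarithm on `ℂ`, push forward
  have hΦc : Continuous fun w => φ (lift (ρ w)) :=
    hφ.comp_continuous (hlift_cont.comp hρ_cont) fun w => hlift_mem (ρ w) (hρ_norm w)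
  have hΦ0 : ∀ w, φ (lift (ρ w)) ≠ 0 := fun w => h0 _ (hlift_mem (ρ w) (hρ_norm w))
  obtain ⟨Ψ, hΨc, hΨ⟩ := PlaneTopology.Janiszewski.exists_continuous_log hΦc hΦ0
  refine ⟨fun x => Ψ (proj x), hΨc.comp hproj_cont, fun x hx hsx => ?_⟩
  simp only [hΨ, hρ_id (proj x) (hproj_le x hx), hlift_proj x hx hsx]

/-! ### Logarithms on the whole sphere -/

/-- The equator `{x ∈ S_r(x₀) : (x − x₀)₂ = 0}` is the range of `t ↦ x₀ + (r cos t, r sin t, 0)`, hence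
preconnected. [folklore] -/
private theorem isPreconnected_equator (x₀ : EuclideanSpace ℝ (Fin 3)) {r : ℝ} (hr : 0 < r) :
    IsPreconnected {x : EuclideanSpace ℝ (Fin 3) | x ∈ sphere x₀ r ∧ (x - x₀) 2 = 0} := by
  set γ : ℝ → EuclideanSpace ℝ (Fin 3) := fun t => x₀ +
    ((r * Real.cos t) • EuclideanSpace.single (0 : Fin 3) (1 : ℝ)
      + (r * Real.sin t) • EuclideanSpace.single (1 : Fin 3) (1 : ℝ)
      + (0 : ℝ) • EuclideanSpace.single (2 : Fin 3) (1 : ℝ)) with hγ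
  have hγc : Continuous γ := by
    refine continuous_const.add (((?_ : Continuous _).add ?_).add continuous_const)
    · exact (continuous_const.mul Real.continuous_cos).smul continuous_const
    · exact (continuous_const.mul Real.continuous_sin).smul continuous_const
  have hγ0 : ∀ t, (γ t - x₀) 0 = r * Real.cos t := by intro t; simp [hγ]
  have hγ1 : ∀ t, (γ t - x₀) 1 = r * Real.sin t := by intro t; simp [hγ]
  have hγ2 : ∀ t, (γ t - x₀) 2 = 0 := by intro t; simp [hγ]
  suffices h : {x : EuclideanSpace ℝ (Fin 3) | x ∈ sphere x₀ r ∧ (x - x₀) 2 = 0} = range γ by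
    rw [h]; exact isPreconnected_range hγc
  refine Subset.antisymm ?_ ?_
  · rintro x ⟨hx, hx2⟩
    -- polar form of the planar projection
    set w : ℂ := ((x - x₀) 0 : ℂ) + ((x - x₀) 1 : ℂ) * I with hw
    have hwn : ‖w‖ = r := by
      have h1 : ‖w‖ ^ 2 = r ^ 2 := by
        rw [mem_sphere_iff_norm] at hx
        rw [hw, norm_sq_ofReal_add_ofReal_mul_I, ← hx, norm_sq_eq_coord, hx2]; ring
      nlinarith [norm_nonneg w]
    have hpol := Complex.norm_mul_exp_arg_mul_I w
    rw [hwn] at hpol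
    have hre : (x - x₀) 0 = r * Real.cos (arg w) := by
      have := congrArg Complex.re hpol
      rw [(re_ofReal_add_ofReal_mul_I _ _).1] at this
      rw [← this, Complex.re_ofReal_mul, Complex.exp_ofReal_mul_I_re]
    have him : (x - x₀) 1 = r * Real.sin (arg w) := by
      have := congrArg Complex.im hpol
      rw [(re_ofReal_add_ofReal_mul_I _ _).2] at this
      rw [← this, Complex.im_ofReal_mul, Complex.exp_ofReal_mul_I_im]
    refine ⟨arg w, ?_⟩
    rw [← sub_left_inj (a := x₀)]
    ext i
    fin_cases i
    · exact (hγ0 _).trans hre.symm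
    · exact (hγ1 _).trans him.symm
    · exact (hγ2 _).trans hx2.symm
  · rintro _ ⟨t, rfl⟩
    refine ⟨?_, hγ2 t⟩
    have hsq : ‖γ t - x₀‖ ^ 2 = r ^ 2 := by
      rw [norm_sq_eq_coord, hγ0, hγ1, hγ2, mul_pow, mul_pow]
      nlinarith [Real.cos_sq_add_sin_sq t]
    rw [mem_sphere_iff_norm]
    nlinarith [norm_nonneg (γ t - x₀)]

/-- **Every continuous nowhere-vanishing `φ : S_r(x₀) → ℂ` (`r > 0`) has a continuous logarithm** — the 2-sphere is
simply connected (Eilenberg 1936, §1; Kuratowski, *Topology* II §57).  Proof: logarithms on the two closed hemispheres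
(`exists_log_cap`) glued along the connected equator (`exists_log_union`). [cite: Kuratowski1968, §56 VI] -/
theorem exists_log_sphere (x₀ : EuclideanSpace ℝ (Fin 3)) {r : ℝ} (hr : 0 < r)
    {φ : EuclideanSpace ℝ (Fin 3) → ℂ} (hφ : ContinuousOn φ (sphere x₀ r)) (h0 : ∀ x ∈ sphere x₀ r, φ x ≠ 0) :
    ∃ ψ : EuclideanSpace ℝ (Fin 3) → ℂ, ContinuousOn ψ (sphere x₀ r) ∧ ∀ x ∈ sphere x₀ r, exp (ψ x) = φ x := by
  have hc2 : Continuous fun x : EuclideanSpace ℝ (Fin 3) => (x - x₀) 2 :=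
    (continuous_coord 2).comp (continuous_id.sub continuous_const)
  set A : Set (EuclideanSpace ℝ (Fin 3)) := sphere x₀ r ∩ {x | 0 ≤ (1 : ℝ) * (x - x₀) 2} with hA
  set B : Set (EuclideanSpace ℝ (Fin 3)) := sphere x₀ r ∩ {x | 0 ≤ (-1 : ℝ) * (x - x₀) 2} with hB
  have hAc : IsClosed A := isClosed_sphere.inter (isClosed_le continuous_const (continuous_const.mul hc2))
  have hBc : IsClosed B := isClosed_sphere.inter (isClosed_le continuous_const (continuous_const.mul hc2))
  obtain ⟨ψA, hψA, hA'⟩ := exists_log_cap x₀ hr (s := 1) (Or.inl rfl) hφ h0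
  obtain ⟨ψB, hψB, hB'⟩ := exists_log_cap x₀ hr (s := -1) (Or.inr rfl) hφ h0
  have hAB : IsPreconnected (A ∩ B) := by
    have h : A ∩ B = {x : EuclideanSpace ℝ (Fin 3) | x ∈ sphere x₀ r ∧ (x - x₀) 2 = 0} := by
      ext x
      simp only [hA, hB, mem_inter_iff, mem_setOf_eq, one_mul, neg_one_mul, Left.nonneg_neg_iff]
      constructor
      · rintro ⟨⟨hx, h1⟩, -, h2⟩; exact ⟨hx, le_antisymm h2 h1⟩
      · rintro ⟨hx, h⟩; exact ⟨⟨hx, h.symm.le⟩, hx, h.le⟩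
    rw [h]; exact isPreconnected_equator x₀ hr
  obtain ⟨g, hg, hg'⟩ := exists_log_union hAc hBc hAB (f := φ) (fun z hz => h0 z hz.1)
    (hψA.continuousOn) (fun z hz => hA' z hz.1 hz.2) (hψB.continuousOn) (fun z hz => hB' z hz.1 hz.2)
  have hcover : sphere x₀ r ⊆ A ∪ B := by
    intro x hx
    rcases le_total 0 ((x - x₀) 2) with h | h
    · exact Or.inl ⟨hx, by simpa using h⟩
    · exact Or.inr ⟨hx, by simpa using h⟩
  exact ⟨g, hg.mono hcover, fun x hx => hg' x (hcover hx)⟩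

/-! ### Unicoherence of the 2-sphere (Eilenberg's argument) -/

/-- **The 2-sphere is unicoherent** (Eilenberg 1936; Kuratowski, *Topology* II §57; Whyburn, *Analytic Topology* XI):
if `A, B ⊆ S_r(x₀)` (`r > 0`) are closed and preconnected with `A ∪ B ⊇ S_r(x₀)`, then `A ∩ B` is preconnected.
Eilenberg's argument: otherwise `A ∩ B = C₁ ⊔ C₂` with `C₁, C₂` closed nonempty; a Urysohn function `θ` (`0` on `C₁`,
`1` on `C₂`) gives the nowhere-vanishing map `x ↦ e^{iπθ(x)}` on `A`, `e^{−iπθ(x)}` on `B` (they agree on `A ∩ B`); a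
logarithm `ψ` (`exists_log_sphere`) has `ψ − iπθ` constant on `A` and `ψ + iπθ` constant on `B`, and comparing a point
of `C₁` with a point of `C₂` gives `2πi = 0`. [cite: Kuratowski1968, §57 III Thm 9 (unicoherence of Sⁿ, n ≥ 2)] -/
theorem isPreconnected_inter (x₀ : EuclideanSpace ℝ (Fin 3)) {r : ℝ} (hr : 0 < r)
    {A B : Set (EuclideanSpace ℝ (Fin 3))} (hA : IsClosed A) (hB : IsClosed B)
    (hAc : IsPreconnected A) (hBc : IsPreconnected B)
    (hAs : A ⊆ sphere x₀ r) (hBs : B ⊆ sphere x₀ r) (hAB : sphere x₀ r ⊆ A ∪ B) :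
    IsPreconnected (A ∩ B) := by
  classical
  rw [isPreconnected_iff_subset_of_disjoint_closed]
  intro u v hu hv huv hdisj
  by_contra hcon
  obtain ⟨hnu, hnv⟩ := not_or.1 hcon
  -- the two closed nonempty disjoint pieces
  set C₁ := A ∩ B ∩ u with hC₁
  set C₂ := A ∩ B ∩ v with hC₂
  have hC₁c : IsClosed C₁ := (hA.inter hB).inter hu
  have hC₂c : IsClosed C₂ := (hA.inter hB).inter hv
  obtain ⟨p, hp⟩ : C₂.Nonempty := by
    obtain ⟨p, hpAB, hpu⟩ := not_subset.1 hnu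
    exact ⟨p, hpAB, (huv hpAB).resolve_left hpu⟩
  obtain ⟨q, hq⟩ : C₁.Nonempty := by
    obtain ⟨q, hqAB, hqv⟩ := not_subset.1 hnv
    exact ⟨q, hqAB, (huv hqAB).resolve_right hqv⟩
  have hd : Disjoint C₁ C₂ := by
    rw [Set.disjoint_iff]
    rintro x ⟨⟨hxAB, hxu⟩, -, hxv⟩
    exact (Set.ext_iff.1 hdisj x).1 ⟨hxAB, hxu, hxv⟩
  obtain ⟨θ, hθ₁, hθ₂, hθ01⟩ := exists_continuous_zero_one_of_isClosed hC₁c hC₂c hd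
  -- the circle-valued map and its logarithm
  set φ : EuclideanSpace ℝ (Fin 3) → ℂ :=
    fun x => if x ∈ A then exp ((Real.pi * θ x : ℝ) * I) else exp (-((Real.pi * θ x : ℝ) * I)) with hφ
  have hθc : Continuous fun x => ((Real.pi * θ x : ℝ) : ℂ) * I :=
    (continuous_ofReal.comp (continuous_const.mul θ.continuous)).mul continuous_const
  have hagree : ∀ x ∈ A ∩ B, exp ((Real.pi * θ x : ℝ) * I) = exp (-((Real.pi * θ x : ℝ) * I)) := by
    intro x hxAB
    rcases huv hxAB with hxu | hxv
    · have h0 : θ x = 0 := hθ₁ ⟨hxAB, hxu⟩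
      simp [h0]
    · have h1 : θ x = 1 := hθ₂ ⟨hxAB, hxv⟩
      rw [h1, mul_one, Complex.exp_neg, Complex.exp_pi_mul_I]; norm_num
  have hφA : ∀ x ∈ A, φ x = exp ((Real.pi * θ x : ℝ) * I) := fun x hx => by simp [hφ, hx]
  have hφB : ∀ x ∈ B, φ x = exp (-((Real.pi * θ x : ℝ) * I)) := by
    intro x hx
    by_cases hxA : x ∈ A
    · rw [hφA x hxA, hagree x ⟨hxA, hx⟩]
    · simp [hφ, hxA]
  have hφc : ContinuousOn φ (sphere x₀ r) := by
    refine (ContinuousOn.union_of_isClosed ?_ ?_ hA hB).mono hAB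
    · exact (hθc.cexp.continuousOn).congr fun x hx => hφA x hx
    · exact (hθc.neg.cexp.continuousOn).congr fun x hx => hφB x hx
  have hφ0 : ∀ x ∈ sphere x₀ r, φ x ≠ 0 := by
    intro x _
    by_cases hxA : x ∈ A <;> simp [hφ, hxA, exp_ne_zero]
  obtain ⟨ψ, hψc, hψ⟩ := exists_log_sphere x₀ hr hφc hφ0
  -- `ψ - iπθ` is constant on `A`, `ψ + iπθ` is constant on `B`
  set T : Set ℂ := (AddSubgroup.zmultiples (2 * Real.pi * I) : Set ℂ) with hT
  have hTd : IsDiscrete T := isDiscrete_iff_discreteTopology.2 (NormedSpace.discreteTopology_zmultiples _)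
  have hmemT : ∀ z : ℂ, exp z = 1 → z ∈ T := by
    intro z hz
    obtain ⟨n, hn⟩ := exp_eq_one_iff.1 hz
    rw [hT, SetLike.mem_coe, AddSubgroup.mem_zmultiples_iff]
    exact ⟨n, by simp only [hn, zsmul_eq_mul]⟩
  have hconstA : ψ q - (Real.pi * θ q : ℝ) * I = ψ p - (Real.pi * θ p : ℝ) * I := by
    refine hAc.constant_of_mapsTo hTd ((hψc.mono hAs).sub hθc.continuousOn) (fun x hx => hmemT _ ?_)
      hq.1.1 hp.1.1
    rw [Pi.sub_apply, exp_sub, hψ x (hAs hx), hφA x hx, div_self (exp_ne_zero _)]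
  have hconstB : ψ q + (Real.pi * θ q : ℝ) * I = ψ p + (Real.pi * θ p : ℝ) * I := by
    refine hBc.constant_of_mapsTo hTd ((hψc.mono hBs).add hθc.continuousOn) (fun x hx => hmemT _ ?_)
      hq.1.2 hp.1.2
    rw [Pi.add_apply, exp_add, hψ x (hBs hx), hφB x hx, ← exp_add, neg_add_cancel, exp_zero]
  have hq0 : θ q = 0 := hθ₁ hq
  have hp1 : θ p = 1 := hθ₂ hp
  rw [hq0, hp1, mul_zero, mul_one, Complex.ofReal_zero, zero_mul, sub_zero] at hconstA
  rw [hq0, hp1, mul_zero, mul_one, Complex.ofReal_zero, zero_mul, add_zero] at hconstB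
  have h : (2 * Real.pi : ℂ) * I = 0 := by linear_combination hconstA - hconstB
  have h' := congrArg Complex.im h
  simp at h'

/-! ### Level sets of functions with connected strict super- and sub-level sets -/

/-- For `f` continuous on the sphere `S_r(x₀)` with all strict superlevel sets `{f > c}` preconnected, every closed
superlevel set `{f ≥ c}` is preconnected: it is the intersection of the decreasing sequence of compact connected sets
`closure {f > c − 1/(n+1)}` (Kuratowski, *Topology* II §47 III: a decreasing sequence of continua has a continuum as
intersection). [cite: Kuratowski1968, §47 III Thm 5] -/
theorem isPreconnected_superlevel (f : EuclideanSpace ℝ (Fin 3) → ℝ) (x₀ : EuclideanSpace ℝ (Fin 3)) (r : ℝ)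
    (hf : ContinuousOn f (sphere x₀ r))
    (hsup : ∀ c : ℝ, IsPreconnected {x : EuclideanSpace ℝ (Fin 3) | ‖x - x₀‖ = r ∧ c < f x}) (c : ℝ) :
    IsPreconnected {x : EuclideanSpace ℝ (Fin 3) | ‖x - x₀‖ = r ∧ c ≤ f x} := by
  set D : ℕ → Set (EuclideanSpace ℝ (Fin 3)) :=
    fun n => closure {x | ‖x - x₀‖ = r ∧ c - 1 / ((n : ℝ) + 1) < f x} with hD
  have hclosed : ∀ c' : ℝ, IsClosed {x : EuclideanSpace ℝ (Fin 3) | ‖x - x₀‖ = r ∧ c' ≤ f x} := by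
    intro c'
    have h := hf.preimage_isClosed_of_isClosed isClosed_sphere (isClosed_Ici (a := c'))
    convert h using 1
    ext x; simp [mem_sphere_iff_norm]
  have hDsub : ∀ n, D n ⊆ {x | ‖x - x₀‖ = r ∧ c - 1 / ((n : ℝ) + 1) ≤ f x} := fun n =>
    closure_minimal (fun x hx => ⟨hx.1, hx.2.le⟩) (hclosed _)
  have hanti : Antitone D := by
    intro m n hmn
    refine closure_mono fun x hx => ⟨hx.1, lt_of_le_of_lt ?_ hx.2⟩
    have : (1 : ℝ) / ((n : ℝ) + 1) ≤ 1 / ((m : ℝ) + 1) :=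
      one_div_le_one_div_of_le (by positivity) (by exact_mod_cast Nat.succ_le_succ hmn)
    linarith
  have hcpt : ∀ n, IsCompact (D n) := fun n =>
    (isCompact_sphere x₀ r).closure_of_subset fun x hx => mem_sphere_iff_norm.2 hx.1
  have hconn : ∀ n, IsPreconnected (D n) := fun n => (hsup _).closure
  have key := FourManifolds.isPreconnected_iInter_of_antitone hanti hcpt hconn
  convert key using 1
  refine Subset.antisymm ?_ ?_
  · intro x hx
    refine mem_iInter.2 fun n => subset_closure ⟨hx.1, lt_of_lt_of_le ?_ hx.2⟩
    have : (0 : ℝ) < 1 / ((n : ℝ) + 1) := by positivity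
    linarith
  · intro x hx
    rw [mem_iInter] at hx
    refine ⟨(hDsub 0 (hx 0)).1, le_of_forall_pos_lt_add fun ε hε => ?_⟩
    obtain ⟨n, hn⟩ := exists_nat_one_div_lt hε
    have h := (hDsub n (hx n)).2
    linarith

/-- The same for closed sublevel sets `{f ≤ c}` (apply `isPreconnected_superlevel` to `−f`).
[cite: Kuratowski1968, §47 III Thm 5] -/
theorem isPreconnected_sublevel (f : EuclideanSpace ℝ (Fin 3) → ℝ) (x₀ : EuclideanSpace ℝ (Fin 3)) (r : ℝ)
    (hf : ContinuousOn f (sphere x₀ r))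
    (hsub : ∀ c : ℝ, IsPreconnected {x : EuclideanSpace ℝ (Fin 3) | ‖x - x₀‖ = r ∧ f x < c}) (c : ℝ) :
    IsPreconnected {x : EuclideanSpace ℝ (Fin 3) | ‖x - x₀‖ = r ∧ f x ≤ c} := by
  have h := isPreconnected_superlevel (fun x => -f x) x₀ r hf.neg (fun c' => ?_) (-c)
  · convert h using 1
    ext x; simp only [mem_setOf_eq, neg_le_neg_iff]
  · convert hsub (-c') using 1
    ext x; simp only [mem_setOf_eq, lt_neg]

/-- **Level sets of a saddle-free function on the 2-sphere are connected.**  If `f` is continuous on `S_r(x₀)`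
(`r > 0`) and all its strict super- and sub-level sets are preconnected, then every level set `{f = c}` is
preconnected: `{f ≥ c}` and `{f ≤ c}` are closed, preconnected, cover the sphere, and the sphere is unicoherent
(`isPreconnected_inter`). [cite: Kuratowski1968, §57 III Thm 9] -/
theorem isPreconnected_levelSet (f : EuclideanSpace ℝ (Fin 3) → ℝ) (x₀ : EuclideanSpace ℝ (Fin 3)) {r : ℝ}
    (hr : 0 < r) (hf : ContinuousOn f (sphere x₀ r))
    (hsup : ∀ c : ℝ, IsPreconnected {x : EuclideanSpace ℝ (Fin 3) | ‖x - x₀‖ = r ∧ c < f x})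
    (hsub : ∀ c : ℝ, IsPreconnected {x : EuclideanSpace ℝ (Fin 3) | ‖x - x₀‖ = r ∧ f x < c}) (c : ℝ) :
    IsPreconnected {x : EuclideanSpace ℝ (Fin 3) | ‖x - x₀‖ = r ∧ f x = c} := by
  have hge := isPreconnected_superlevel f x₀ r hf hsup c
  have hle := isPreconnected_sublevel f x₀ r hf hsub c
  have hcl : ∀ s : Set ℝ, IsClosed s → IsClosed {x : EuclideanSpace ℝ (Fin 3) | ‖x - x₀‖ = r ∧ f x ∈ s} := by
    intro s hs
    have h := hf.preimage_isClosed_of_isClosed isClosed_sphere hs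
    convert h using 1
    ext x; simp [mem_sphere_iff_norm]
  have h := isPreconnected_inter x₀ hr (hcl _ isClosed_Ici) (hcl _ isClosed_Iic) hge hle
    (fun x hx => mem_sphere_iff_norm.2 hx.1) (fun x hx => mem_sphere_iff_norm.2 hx.1)
    (fun x hx => (le_total c (f x)).imp (fun h => ⟨mem_sphere_iff_norm.1 hx, h⟩)
      (fun h => ⟨mem_sphere_iff_norm.1 hx, h⟩))
  convert h using 1
  ext x
  simp only [mem_setOf_eq, mem_inter_iff, mem_Ici, mem_Iic]
  constructor
  · rintro ⟨h1, h2⟩; exact ⟨⟨h1, h2.ge⟩, h1, h2.le⟩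
  · rintro ⟨⟨h1, h2⟩, -, h3⟩; exact ⟨h1, le_antisymm h3 h2⟩

end SphereUnicoherence

end Literature.Topology.Euclidean
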